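import Summits.HodgeConjecture.CorCM.Model.PoincareClass
import Summits.HodgeConjecture.CorCM.Model.KunnethOneOne
import Mathlib.LinearAlgebra.Alternating.Uncurry.Fin
import HarnessLib

/-!
# COR-CM model layer, row M22 `Fact_algDuality`, kernel K-b (part 3): contractions of `H•(X; ℚ) = ⋀• H¹` against
# linear forms, the polar family as a contraction, and its NONDEGENERACY `θ^g ≠ 0 ⇒ (y_a)_a` is a basis

Cell `pub-hodgecm2` (COR-CM), seat `b16`, row M22 K-b; this is the input «the polar family is a basis» of K-a's clause (o)
(bijectivity of the Fourier-type operator `D z = Σ_c tr(z ∪ x_c) • y_c`, `Model/FourierOpInjective.lean` takes `y` as a basis).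
TEMPLATE: `Motives/AbelianVarietyExterior.lean`, `contrOne`/`contrOne_cup`/`contrOne_prodMap`/`contrOne_pow`/
`polarization_injective` (:101–:651), there over an abstract Weil cohomology through its coproduct; HERE on the real carriers
`Hᵏ(X(ℂ); ℚ)` through the exterior-algebra structure `H• = ⋀• H¹` (`HasExteriorCohomologyH1 ℚ`, the cell's
`hasExteriorCohomologyH1_rat`) and Mathlib's `AlternatingMap.alternatizeUncurryFin` (the alternating map
`v ↦ Σ_p (-1)^p φ(v_p) m_d(v ∘ p.succAbove)`), with NO new definition: the contractions are produced by an existence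
theorem and consumed through their defining formula.

## What is proved (definition-free)

* `exists_contraction` — for a space `T` with `H•(T; ℚ) = ⋀• H¹` and `φ ∈ H¹(T; ℚ)^∨` there are linear maps
  `D_d : H^{d+1} → H^d` with `D_d(v₀ ∪ ⋯ ∪ v_d) = Σ_p (-1)^p φ(v_p) • (v₀ ∪ ⋯ v̂_p ⋯ ∪ v_d)` (graded derivation extending `φ`).
* `contraction_cup_one` (`D(x ∪ z) = φ(x) z - x ∪ D z`), `contraction_zero`, `contraction_cup_one_one`
  (`D(x ∪ z) = φ(x) z - φ(z) x` on `H¹ ∪ H¹`), `contraction_two_cup` (`D(θ ∪ z) = Dθ ∪ z + θ ∪ Dz` for `θ ∈ H²`),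
  `contraction_cupPow` (`D(θ^{k+1}) = (k+1) • Dθ ∪ θ^k`), `cup_contraction_top` (`x ∪ D ω = φ(x) ω` on the top degree).
* `polClass_eq_sum_contraction`, `polarFamily_eq_contraction` — for an abelian variety `A`, a basis `b` of `H¹(A(ℂ); ℚ)`:
  `ℓ(θ) = Σ_a pr₁^* b_a ∪ pr₂^* D_{b^*_a} θ`, so the polar family `y` of `θ` (`ℓ(θ) = Σ_a pr₁^* b_a ∪ pr₂^* y_a`) is `y_a = D_{b^*_a} θ`.
* `smul_cup_polar_cup_cupPow` — **`(k+1) • b_a ∪ y_{a'} ∪ θ^k = δ_{a a'} • θ^{k+1}`** for `k + 1 = dim A` (so `y` is `tr θ^g / g`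
  times the dual basis of `b` for the pairing `(x, z) ↦ tr(x ∪ z ∪ θ^{g-1})` — the shape in which R2 delivers the Rosati form);
  hence `polarFamily_linearIndependent` / `polarFamily_span_eq_top` — **`θ^{dim A} ≠ 0 ⇒` the polar family is a basis of
  `H¹(A(ℂ); ℚ)`**.

## References
* [MumfordAV1970] D. Mumford, *Abelian Varieties* (1970), §1 (4), §16 (Riemann–Roch, `K(L)` finite for `L` nondegenerate).
* [Kleiman1968AlgebraicCycles] S. Kleiman, *Algebraic cycles and the Weil conjectures* (1968), App. 2A (2A8–2A11).
* [LangeBirkenhake1992] H. Lange, Ch. Birkenhake, *Complex Abelian Varieties* (1992), Lemma 1.1.17; (2023 ed.) §6.2.4.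
-/

noncomputable section

open CategoryTheory MonoidalCategory CartesianMonoidalCategory
open Literature.AlgebraicTopology.SingularHomology
open Literature.AlgebraicTopology.CharacteristicClasses (cupPow cupPow_zero cupPow_succ)
open Literature.AlgebraicGeometry.Motives (SchemeOver ComplexPoints IsSmoothProjective bettiCohomology AbelianVariety)
open Literature.AlgebraicGeometry.HodgeTheory
open Literature.NumberTheory.Automorphic.PicardCM

namespace Summit.HodgeConjecture.CorCM.Model

/-! ### Contractions `D_φ : H^{d+1}(T; ℚ) → H^d(T; ℚ)` for a space with `H• = ⋀• H¹` -/

section Contraction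

variable {T : Type} [TopologicalSpace T]

/-- `removeNth (k+1) (cons x w) = cons x (removeNth k w)`. [folklore] -/
theorem removeNth_succ_cons {M : Type*} {d : ℕ} (k : Fin (d + 1)) (x : M) (w : Fin (d + 1) → M) :
    k.succ.removeNth (Fin.cons x w : Fin (d + 2) → M) = Fin.cons x (k.removeNth w) := by
  funext i
  cases i using Fin.cases with
  | zero => simp [Fin.removeNth_apply]
  | succ j => simp [Fin.removeNth_apply]

/-- **Existence of the contraction (interior product) against a linear form.** If `H•(T; ℚ) = ⋀• H¹(T; ℚ)`
(`HasExteriorCohomologyH1`), then for every `φ ∈ H¹(T; ℚ)^∨` there are linear maps `D_d : H^{d+1}(T; ℚ) → H^d(T; ℚ)`,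
`d ≥ 0`, with `D_d(v₀ ∪ ⋯ ∪ v_d) = Σ_p (-1)^p φ(v_p) • m_d(v ∘ p.succAbove)` on iterated products of degree-one classes
(the graded derivation of the exterior algebra extending `φ`; Mathlib's `AlternatingMap.alternatizeUncurryFin` of
`x ↦ φ(x) • m_d`, descended to `Hᵈ⁺¹ ≅ ⋀ᵈ⁺¹ H¹`).  Template: `Motives.WeilCohomology.contrOne` / `contrOne_prodMap`. [cite: Kleiman1968AlgebraicCycles, App. 2A (2A8–2A11)] -/
theorem exists_contraction (h : HasExteriorCohomologyH1 ℚ T) (φ : Module.Dual ℚ (singularCohomology ℚ ℚ T 1)) :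
    ∃ D : (d : ℕ) → (singularCohomology ℚ ℚ T (d + 1) →ₗ[ℚ] singularCohomology ℚ ℚ T d),
      ∀ (d : ℕ) (v : Fin (d + 1) → singularCohomology ℚ ℚ T 1),
        D d (cupPowOne ℚ T (d + 1) v) =
          ∑ p : Fin (d + 1), (-1 : ℚ) ^ (p : ℕ) • φ (v p) • cupPowOne ℚ T d (p.removeNth v) := by
  refine ⟨fun d ↦ (exteriorPower.alternatingMapLinearEquiv
      (AlternatingMap.alternatizeUncurryFin (φ.smulRight (cupPowOneAlt ℚ T d)))) ∘ₗ
      (LinearEquiv.ofBijective (wedgeToCup ℚ T (d + 1)) (h (d + 1))).symm.toLinearMap, fun d v ↦ ?_⟩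
  have hv : (LinearEquiv.ofBijective (wedgeToCup ℚ T (d + 1)) (h (d + 1))).symm (cupPowOne ℚ T (d + 1) v) =
      exteriorPower.ιMulti ℚ (d + 1) v := by
    rw [LinearEquiv.symm_apply_eq, LinearEquiv.ofBijective_apply, wedgeToCup_ιMulti]
  rw [LinearMap.comp_apply, LinearEquiv.coe_toLinearMap, hv,
    exteriorPower.alternatingMapLinearEquiv_apply_ιMulti, AlternatingMap.alternatizeUncurryFin_apply]
  refine Finset.sum_congr rfl fun p _ ↦ ?_
  rw [LinearMap.smulRight_apply, AlternatingMap.smul_apply, cupPowOneAlt_apply, ← Int.cast_smul_eq_zsmul ℚ,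
    Int.cast_pow, Int.cast_neg, Int.cast_one]

variable (φ : Module.Dual ℚ (singularCohomology ℚ ℚ T 1))
  (D : (d : ℕ) → (singularCohomology ℚ ℚ T (d + 1) →ₗ[ℚ] singularCohomology ℚ ℚ T d))

/-- **Leibniz rule against a degree-one class**: `D(x ∪ z) = φ(x) • z - x ∪ D z` for `x ∈ H¹`, `z ∈ H^{d+1}`
(from the defining formula on products; `H^{d+1}` is spanned by products). Template: `contrOne_cup`. [folklore] -/
theorem contraction_cup_one (h : HasExteriorCohomologyH1 ℚ T)
    (hD : ∀ (d : ℕ) (v : Fin (d + 1) → singularCohomology ℚ ℚ T 1), D d (cupPowOne ℚ T (d + 1) v) =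
      ∑ p : Fin (d + 1), (-1 : ℚ) ^ (p : ℕ) • φ (v p) • cupPowOne ℚ T d (p.removeNth v))
    (d : ℕ) (x : singularCohomology ℚ ℚ T 1) (z : singularCohomology ℚ ℚ T (d + 1)) :
    D (d + 1) (cupProduct (Nat.add_comm 1 (d + 1)) x z) =
      φ x • z - cupProduct (Nat.add_comm 1 d) x (D d z) := by
  have hz : z ∈ Submodule.span ℚ (Set.range (cupPowOne ℚ T (d + 1))) := by
    rw [h.span_range_cupPowOne]; exact Submodule.mem_top
  induction hz using Submodule.span_induction with
  | mem z hz =>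
    obtain ⟨w, rfl⟩ := hz
    rw [cupProduct_cupPowOne, hD, hD, Fin.sum_univ_succ]
    simp only [Fin.val_zero, pow_zero, one_smul, Fin.cons_zero, Fin.removeNth_zero, Fin.tail_cons, Fin.val_succ,
      pow_succ, Fin.cons_succ, mul_neg, mul_one, neg_smul, Finset.sum_neg_distrib, map_sum, map_smul,
      removeNth_succ_cons, ← cupProduct_cupPowOne]
    abel
  | zero => simp
  | add z z' _ _ hz hz' => rw [LinearMap.map_add, map_add, hz, hz', map_add, LinearMap.map_add, smul_add]; abel
  | smul r z _ hz => rw [LinearMap.map_smul, map_smul, hz, map_smul, LinearMap.map_smul, smul_sub, smul_comm]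

/-- `D₀ z = φ(z) • 1` on `H¹`. [folklore] -/
theorem contraction_zero
    (hD : ∀ (d : ℕ) (v : Fin (d + 1) → singularCohomology ℚ ℚ T 1), D d (cupPowOne ℚ T (d + 1) v) =
      ∑ p : Fin (d + 1), (-1 : ℚ) ^ (p : ℕ) • φ (v p) • cupPowOne ℚ T d (p.removeNth v))
    (z : singularCohomology ℚ ℚ T 1) : D 0 z = φ z • singularCohomology.one ℚ T := by
  have h := hD 0 (fun _ ↦ z)
  rw [cupPowOne_one] at h
  rw [h, Fin.sum_univ_one]
  simp

/-- `D₁(x ∪ z) = φ(x) • z - φ(z) • x` for `x, z ∈ H¹`. Template: `contrOne` on `Δ_{1,1}(x ∪ z) = x ⊗ z - z ⊗ x`. [folklore] -/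
theorem contraction_cup_one_one (h : HasExteriorCohomologyH1 ℚ T)
    (hD : ∀ (d : ℕ) (v : Fin (d + 1) → singularCohomology ℚ ℚ T 1), D d (cupPowOne ℚ T (d + 1) v) =
      ∑ p : Fin (d + 1), (-1 : ℚ) ^ (p : ℕ) • φ (v p) • cupPowOne ℚ T d (p.removeNth v))
    (x z : singularCohomology ℚ ℚ T 1) :
    D 1 (cupProduct (Nat.add_comm 1 1) x z) = φ x • z - φ z • x := by
  rw [contraction_cup_one φ D h hD 0 x z, contraction_zero φ D hD z, map_smul, cupProduct_one]

/-- **Leibniz rule against a degree-two class** (no sign: even degree): `D(θ ∪ z) = D θ ∪ z + θ ∪ D z` for `θ ∈ H²`,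
`z ∈ H^{d+1}`. Template: `contrOne_cup_deg_two`. [folklore] -/
theorem contraction_two_cup (h : HasExteriorCohomologyH1 ℚ T)
    (hD : ∀ (d : ℕ) (v : Fin (d + 1) → singularCohomology ℚ ℚ T 1), D d (cupPowOne ℚ T (d + 1) v) =
      ∑ p : Fin (d + 1), (-1 : ℚ) ^ (p : ℕ) • φ (v p) • cupPowOne ℚ T d (p.removeNth v))
    (d : ℕ) (θ : singularCohomology ℚ ℚ T 2) (z : singularCohomology ℚ ℚ T (d + 1)) :
    D (d + 2) (cupProduct (show 2 + (d + 1) = d + 3 by omega) θ z) =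
      cupProduct (show 1 + (d + 1) = d + 2 by omega) (D 1 θ) z +
        cupProduct (show 2 + d = d + 2 by omega) θ (D d z) := by
  have hθ : θ ∈ Submodule.span ℚ (Set.range (cupPowOne ℚ T 2)) := by
    rw [h.span_range_cupPowOne]; exact Submodule.mem_top
  induction hθ using Submodule.span_induction with
  | mem θ hθ =>
    obtain ⟨u, rfl⟩ := hθ
    rw [cupPowOne_succ, cupPowOne_one]
    -- `θ = u₀ ∪ u₁`
    have h1 : cupProduct (show 2 + (d + 1) = d + 3 by omega) (cupProduct (Nat.add_comm 1 1) (u 0) (Fin.tail u 0)) z =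
        cupProduct (Nat.add_comm 1 (d + 2)) (u 0) (cupProduct (Nat.add_comm 1 (d + 1)) (Fin.tail u 0) z) :=
      cupProduct_assoc _ _ _ _ _ _ _
    have h2 : cupProduct (show 2 + d = d + 2 by omega) (cupProduct (Nat.add_comm 1 1) (u 0) (Fin.tail u 0)) (D d z) =
        cupProduct (Nat.add_comm 1 (d + 1)) (u 0) (cupProduct (Nat.add_comm 1 d) (Fin.tail u 0) (D d z)) :=
      cupProduct_assoc _ _ _ _ _ _ _
    rw [h1, contraction_cup_one φ D h hD (d + 1), contraction_cup_one φ D h hD d, h2,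
      contraction_cup_one_one φ D h hD]
    simp only [map_sub, LinearMap.sub_apply, LinearMap.smul_apply, map_smul]
    abel
  | zero => simp
  | add θ θ' _ _ hθ hθ' =>
    rw [LinearMap.map_add₂, map_add, hθ, hθ', map_add, LinearMap.map_add₂, LinearMap.map_add₂]
    abel
  | smul r θ _ hθ =>
    rw [LinearMap.map_smul₂, map_smul, hθ, map_smul, LinearMap.map_smul₂, LinearMap.map_smul₂, smul_add]

/-- **`D(θ^{k+1}) = (k+1) • D θ ∪ θ^k`** for a degree-two class `θ` (Leibniz; `θ` is central, being of even degree).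
Template: `contrOne_pow`. [cite: MumfordAV1970, §16] -/
theorem contraction_cupPow (h : HasExteriorCohomologyH1 ℚ T)
    (hD : ∀ (d : ℕ) (v : Fin (d + 1) → singularCohomology ℚ ℚ T 1), D d (cupPowOne ℚ T (d + 1) v) =
      ∑ p : Fin (d + 1), (-1 : ℚ) ^ (p : ℕ) • φ (v p) • cupPowOne ℚ T d (p.removeNth v))
    (θ : singularCohomology ℚ ℚ T 2) :
    ∀ k : ℕ, D (2 * k + 1) (cupPow ℚ θ (k + 1)) =
      ((k + 1 : ℕ) : ℚ) • cupProduct (show 1 + 2 * k = 2 * k + 1 by omega) (D 1 θ) (cupPow ℚ θ k)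
  | 0 => by
    have e1 : cupPow ℚ θ (0 + 1) = θ := by
      rw [cupPow_succ, cupPow_zero]; exact one_cupProduct θ
    have e2 : cupProduct (show 1 + 2 * 0 = 2 * 0 + 1 by omega) (D 1 θ) (cupPow ℚ θ 0) = D 1 θ := by
      rw [cupPow_zero]; exact cupProduct_one _
    rw [e1, e2]
    simp
  | k + 1 => by
    have ih := contraction_cupPow h hD θ k
    -- `θ^{k+2} = θ^{k+1} ∪ θ = θ ∪ θ^{k+1}`
    have hcomm : cupPow ℚ θ (k + 1 + 1) =
        cupProduct (show 2 + (2 * k + 1 + 1) = 2 * k + 1 + 3 by omega) θ (cupPow ℚ θ (k + 1)) := by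
      rw [cupPow_succ, cupProduct_gradedComm_holds ℚ T _ (show 2 + (2 * k + 1 + 1) = 2 * k + 1 + 3 by omega)]
      norm_num
    have hcomm' : cupProduct (show 2 + 2 * k = 2 * k + 2 by omega) θ (cupPow ℚ θ k) = cupPow ℚ θ (k + 1) := by
      rw [cupPow_succ, cupProduct_gradedComm_holds ℚ T _ (show 2 * k + 2 = 2 * (k + 1) by omega)]
      norm_num
    -- `θ ∪ (Dθ ∪ θ^k) = Dθ ∪ (θ ∪ θ^k)`
    have hswap : cupProduct (show 2 + (2 * k + 1) = 2 * k + 1 + 2 by omega) θ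
        (cupProduct (show 1 + 2 * k = 2 * k + 1 by omega) (D 1 θ) (cupPow ℚ θ k)) =
        cupProduct (show 1 + (2 * k + 1 + 1) = 2 * k + 1 + 2 by omega) (D 1 θ)
          (cupProduct (show 2 + 2 * k = 2 * k + 2 by omega) θ (cupPow ℚ θ k)) := by
      rw [← cupProduct_assoc (show 2 + 1 = 3 by omega) (show 1 + 2 * k = 2 * k + 1 by omega)
          (show 3 + 2 * k = 2 * k + 1 + 2 by omega) (show 2 + (2 * k + 1) = 2 * k + 1 + 2 by omega),
        cupProduct_gradedComm_holds ℚ T (show 2 + 1 = 3 by omega) (show 1 + 2 = 3 by omega) θ (D 1 θ)]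
      norm_num
      exact cupProduct_assoc _ _ _ _ _ _ _
    rw [hcomm]
    refine (contraction_two_cup φ D h hD (2 * k + 1) θ (cupPow ℚ θ (k + 1))).trans ?_
    rw [ih, map_smul, hswap, hcomm']
    change _ = ((k + 1 + 1 : ℕ) : ℚ) •
      cupProduct (show 1 + (2 * k + 1 + 1) = 2 * k + 1 + 2 by omega) (D 1 θ) (cupPow ℚ θ (k + 1))
    rw [show ((k + 1 + 1 : ℕ) : ℚ) = 1 + ((k + 1 : ℕ) : ℚ) by push_cast; ring, add_smul, one_smul]

/-- **On the top degree `x ∪ D ω = φ(x) • ω`**: if `H^{d+2} = 0` then for `x ∈ H¹`, `ω ∈ H^{d+1}` the Leibniz rule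
`0 = D(x ∪ ω) = φ(x) ω - x ∪ D ω` gives `x ∪ D ω = φ(x) ω`. Template: `contrOne_ne_zero_of_top`. [folklore] -/
theorem cup_contraction_top (h : HasExteriorCohomologyH1 ℚ T)
    (hD : ∀ (d : ℕ) (v : Fin (d + 1) → singularCohomology ℚ ℚ T 1), D d (cupPowOne ℚ T (d + 1) v) =
      ∑ p : Fin (d + 1), (-1 : ℚ) ^ (p : ℕ) • φ (v p) • cupPowOne ℚ T d (p.removeNth v))
    (d : ℕ) [Subsingleton (singularCohomology ℚ ℚ T (d + 2))]
    (x : singularCohomology ℚ ℚ T 1) (ω : singularCohomology ℚ ℚ T (d + 1)) :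
    cupProduct (Nat.add_comm 1 d) x (D d ω) = φ x • ω := by
  have h1 := contraction_cup_one φ D h hD d x ω
  rw [Subsingleton.elim (cupProduct (Nat.add_comm 1 (d + 1)) x ω) 0, map_zero] at h1
  exact (sub_eq_zero.1 h1.symm).symm

end Contraction

/-! ### The polar family of an abelian variety is a contraction; nondegeneracy -/

section AbelianVariety

open scoped MonObj

variable (A : AbelianVariety ℂ)

/-- `Hᵈ(A(ℂ); ℚ) = 0` for `d > 2 dim A`. [cite: MumfordAV1970, §1 (4)] -/
theorem subsingleton_bettiCohomology_of_lt {d : ℕ} (hd : 2 * A.dim < d) : Subsingleton (bettiCohomology A.X d) := by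
  haveI : Module.Finite ℚ (singularCohomology ℚ ℚ (ComplexPoints A.X) 1) :=
    finiteDimensional_bettiCohomology (AbelianVariety.isSmoothProjective_holds (A := A)) 1
  refine (hasExteriorCohomologyH1_rat A).subsingleton_of_lt ?_
  change Module.finrank ℚ (bettiCohomology A.X 1) < d
  rwa [finrank_bettiCohomology_abelianVariety, Nat.choose_one_right]

/-- **`ℓ(θ) = Σ_a pr₁^* b_a ∪ pr₂^* D_{b^*_a} θ`**: along a basis `b` of `H¹(A(ℂ); ℚ)`, the contractions of `θ` against
the dual basis form a polar family (value of both sides on cups of degree-one classes, `polClass_cup_one_one_eq_sum` and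
`contraction_cup_one_one`; linearity). Template: `Motives.WeilCohomology.polClass_eq_sum`. [cite: MumfordAV1970, §16] -/
theorem polClass_eq_sum_contraction {n : ℕ} (b : Module.Basis (Fin n) ℚ (bettiCohomology A.X 1))
    (D : Fin n → (d : ℕ) → (bettiCohomology A.X (d + 1) →ₗ[ℚ] bettiCohomology A.X d))
    (hD : ∀ (a : Fin n) (d : ℕ) (v : Fin (d + 1) → bettiCohomology A.X 1),
      D a d (cupPowOne ℚ (ComplexPoints A.X) (d + 1) v) =
        ∑ p : Fin (d + 1), (-1 : ℚ) ^ (p : ℕ) • b.coord a (v p) • cupPowOne ℚ (ComplexPoints A.X) d (p.removeNth v))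
    (θ : bettiCohomology A.X 2) :
    BettiUniverse.pull μ[A.X] 2 θ - BettiUniverse.pull (fst A.X A.X) 2 θ - BettiUniverse.pull (snd A.X A.X) 2 θ =
      ∑ a, BettiUniverse.cup (A.X ⊗ A.X) 1 1 (BettiUniverse.pull (fst A.X A.X) 1 (b a))
        (BettiUniverse.pull (snd A.X A.X) 1 (D a 1 θ)) := by
  have h := hasExteriorCohomologyH1_rat A
  have hθ : θ ∈ Submodule.span ℚ (Set.range (cupPowOne ℚ (ComplexPoints A.X) 2)) := by
    rw [span_range_cupPowOne_rat_eq_top A 2]; exact Submodule.mem_top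
  induction hθ using Submodule.span_induction with
  | mem θ hθ =>
    obtain ⟨u, rfl⟩ := hθ
    rw [cupPowOne_succ, cupPowOne_one]
    refine (polClass_cup_one_one_eq_sum A b (u 0) (Fin.tail u 0)).trans (Finset.sum_congr rfl fun a _ ↦ ?_)
    rw [contraction_cup_one_one (b.coord a) (D a) h (hD a), Module.Basis.coord_apply, Module.Basis.coord_apply]
  | zero => simp
  | add θ θ' _ _ hθ hθ' =>
    simp only [map_add, Finset.sum_add_distrib]
    rw [← hθ, ← hθ']
    abel
  | smul r θ _ hθ =>
    simp only [map_smul, ← Finset.smul_sum]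
    rw [← hθ, smul_sub, smul_sub]

/-- **The polar family is the contraction of `θ` against the dual basis**: for a basis `b` of `H¹(A(ℂ); ℚ)`, the
polar family `y` of `θ` along `b` (`m^*θ - pr₁^*θ - pr₂^*θ = Σ_a pr₁^* b_a ∪ pr₂^* y_a`) satisfies `y_a = D_{b^*_a} θ` for
any contractions `D_{b^*_a}` (as produced by `exists_contraction`) — by `polarFamily_unique` and
`polClass_eq_sum_contraction`.  Template: `Motives.WeilCohomology.polBasis_apply` (`y_a = D_{b^*_a} η`). [cite: MumfordAV1970, §16] -/
theorem polarFamily_eq_contraction {n : ℕ} (b : Module.Basis (Fin n) ℚ (bettiCohomology A.X 1))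
    {θ : bettiCohomology A.X 2} {y : Fin n → bettiCohomology A.X 1}
    (hℓ : BettiUniverse.pull μ[A.X] 2 θ - BettiUniverse.pull (fst A.X A.X) 2 θ - BettiUniverse.pull (snd A.X A.X) 2 θ =
      ∑ a, BettiUniverse.cup (A.X ⊗ A.X) 1 1 (BettiUniverse.pull (fst A.X A.X) 1 (b a))
        (BettiUniverse.pull (snd A.X A.X) 1 (y a)))
    (D : Fin n → (d : ℕ) → (bettiCohomology A.X (d + 1) →ₗ[ℚ] bettiCohomology A.X d))
    (hD : ∀ (a : Fin n) (d : ℕ) (v : Fin (d + 1) → bettiCohomology A.X 1),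
      D a d (cupPowOne ℚ (ComplexPoints A.X) (d + 1) v) =
        ∑ p : Fin (d + 1), (-1 : ℚ) ^ (p : ℕ) • b.coord a (v p) • cupPowOne ℚ (ComplexPoints A.X) d (p.removeNth v))
    (a : Fin n) : y a = D a 1 θ := by
  have hy : y = fun a ↦ D a 1 θ :=
    polarFamily_unique A b (hℓ.symm.trans (polClass_eq_sum_contraction A b D hD θ))
  exact congrFun hy a

/-- **`(k+1) • b_a ∪ y_{a'} ∪ θ^k = δ_{a a'} • θ^{k+1}`** (`k + 1 = dim A`) for a basis `b` of `H¹(A(ℂ); ℚ)` and the polar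
family `y` of `θ` along `b`: `(k+1) y_{a'} ∪ θ^k = D_{a'}(θ^{k+1})` (`contraction_cupPow`) and `x ∪ D_{a'} ω = b^*_{a'}(x) ω`
on the top degree `H^{2 dim A}` (`cup_contraction_top`).  In the pairing form `Q_θ(x, z) = tr(x ∪ z ∪ θ^{g-1})` this says
that `y` is `tr(θ^g)/g` times the `Q_θ`-dual basis of `b`. [cite: MumfordAV1970, §16] -/
theorem smul_cup_polar_cup_cupPow {n k : ℕ} (hk : k + 1 = A.dim) (b : Module.Basis (Fin n) ℚ (bettiCohomology A.X 1))
    {θ : bettiCohomology A.X 2} {y : Fin n → bettiCohomology A.X 1}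
    (hℓ : BettiUniverse.pull μ[A.X] 2 θ - BettiUniverse.pull (fst A.X A.X) 2 θ - BettiUniverse.pull (snd A.X A.X) 2 θ =
      ∑ a, BettiUniverse.cup (A.X ⊗ A.X) 1 1 (BettiUniverse.pull (fst A.X A.X) 1 (b a))
        (BettiUniverse.pull (snd A.X A.X) 1 (y a)))
    (a a' : Fin n) :
    ((k + 1 : ℕ) : ℚ) • cupProduct (Nat.add_comm 1 (2 * k + 1)) (b a)
        (cupProduct (show 1 + 2 * k = 2 * k + 1 by omega) (y a') (cupPow ℚ θ k)) =
      if a = a' then cupPow ℚ θ (k + 1) else 0 := by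
  have h := hasExteriorCohomologyH1_rat A
  have hex := fun c : Fin n ↦ exists_contraction h (b.coord c)
  choose D hD using hex
  haveI : Subsingleton (singularCohomology ℚ ℚ (ComplexPoints A.X) (2 * k + 1 + 2)) :=
    subsingleton_bettiCohomology_of_lt A (by omega)
  rw [polarFamily_eq_contraction A b hℓ D hD a', ← map_smul, ← contraction_cupPow (b.coord a') (D a') h (hD a') θ k,
    cup_contraction_top (b.coord a') (D a') h (hD a') (2 * k + 1) (b a) (cupPow ℚ θ (k + 1)), Module.Basis.coord_apply,
    Module.Basis.repr_self, Finsupp.single_apply]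
  split_ifs <;> simp

/-- **Nondegeneracy of the polar family: `θ^{dim A} ≠ 0 ⇒ (y_a)_a` is linearly independent** (hence a basis of
`H¹(A(ℂ); ℚ)`, `polarFamily_span_eq_top`), for a basis `b` of `H¹(A(ℂ); ℚ)` and the polar family `y` of `θ` along `b`:
a relation `Σ_a κ_a y_a = 0` gives, after `b_{a'} ∪ – ∪ θ^k` and `smul_cup_polar_cup_cupPow`, `κ_{a'} θ^{k+1} = 0`.  This is
the input «`y` is a basis» of K-a's clause (o) (`Model/FourierOpInjective.lean`); classically: the polarization map of a
class with `θ^g ≠ 0` is an isogeny `A → Â` (`K(L)` finite).  Template: `Motives.WeilCohomology.polarization_injective`. [cite: MumfordAV1970, §16] -/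
theorem polarFamily_linearIndependent {n k : ℕ} (hk : k + 1 = A.dim)
    (b : Module.Basis (Fin n) ℚ (bettiCohomology A.X 1))
    {θ : bettiCohomology A.X 2} (hθ : cupPow ℚ θ (k + 1) ≠ 0) {y : Fin n → bettiCohomology A.X 1}
    (hℓ : BettiUniverse.pull μ[A.X] 2 θ - BettiUniverse.pull (fst A.X A.X) 2 θ - BettiUniverse.pull (snd A.X A.X) 2 θ =
      ∑ a, BettiUniverse.cup (A.X ⊗ A.X) 1 1 (BettiUniverse.pull (fst A.X A.X) 1 (b a))
        (BettiUniverse.pull (snd A.X A.X) 1 (y a))) :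
    LinearIndependent ℚ y := by
  refine Fintype.linearIndependent_iff.2 fun κ hκ a' ↦ ?_
  have key : ∀ a, ((k + 1 : ℕ) : ℚ) • cupProduct (Nat.add_comm 1 (2 * k + 1)) (b a')
      (cupProduct (show 1 + 2 * k = 2 * k + 1 by omega) (κ a • y a) (cupPow ℚ θ k)) =
      κ a • (if a' = a then cupPow ℚ θ (k + 1) else 0) := fun a ↦ by
    rw [LinearMap.map_smul₂, map_smul, smul_comm, smul_cup_polar_cup_cupPow A hk b hℓ a' a]
  have hsum : ((k + 1 : ℕ) : ℚ) • cupProduct (Nat.add_comm 1 (2 * k + 1)) (b a')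
      (cupProduct (show 1 + 2 * k = 2 * k + 1 by omega) (∑ a, κ a • y a) (cupPow ℚ θ k)) =
      κ a' • cupPow ℚ θ (k + 1) := by
    rw [LinearMap.map_sum₂, map_sum, Finset.smul_sum, Finset.sum_congr rfl fun a _ ↦ key a]
    simp only [smul_ite, smul_zero, Finset.sum_ite_eq, Finset.mem_univ, if_true]
  rw [hκ, LinearMap.map_zero₂, map_zero, smul_zero] at hsum
  exact (smul_eq_zero.1 hsum.symm).resolve_right hθ

/-- The polar family of a class with `θ^{dim A} ≠ 0` spans `H¹(A(ℂ); ℚ)` (it is linearly independent of the right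
cardinality). [cite: MumfordAV1970, §16] -/
theorem polarFamily_span_eq_top {n k : ℕ} (hk : k + 1 = A.dim)
    (b : Module.Basis (Fin n) ℚ (bettiCohomology A.X 1))
    {θ : bettiCohomology A.X 2} (hθ : cupPow ℚ θ (k + 1) ≠ 0) {y : Fin n → bettiCohomology A.X 1}
    (hℓ : BettiUniverse.pull μ[A.X] 2 θ - BettiUniverse.pull (fst A.X A.X) 2 θ - BettiUniverse.pull (snd A.X A.X) 2 θ =
      ∑ a, BettiUniverse.cup (A.X ⊗ A.X) 1 1 (BettiUniverse.pull (fst A.X A.X) 1 (b a))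
        (BettiUniverse.pull (snd A.X A.X) 1 (y a))) :
    Submodule.span ℚ (Set.range y) = ⊤ := by
  haveI : FiniteDimensional ℚ (bettiCohomology A.X 1) :=
    finiteDimensional_bettiCohomology (AbelianVariety.isSmoothProjective_holds (A := A)) 1
  exact (polarFamily_linearIndependent A hk b hθ hℓ).span_eq_top_of_card_eq_finrank'
    (Module.finrank_eq_card_basis b).symm

end AbelianVariety

end Summit.HodgeConjecture.CorCM.Model

end
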